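import Summits.HubbardSuperconductivity.HubbardSuperconductivity.Theorems.CooperPairDMottWalkCooperPairDMottPlaquettePairBinding
import Summits.HubbardSuperconductivity.HubbardSuperconductivity.Theorems.CooperPairDMottWalkCooperPairDMottUniqueTwoHoleGroundState
import Summits.HubbardSuperconductivity.HubbardSuperconductivity.Theorems.CooperPairDMottWalkCooperPairDMottPlaquetteDWaveElementGram
import Summits.HubbardSuperconductivity.HubbardSuperconductivity.Theorems.CooperPairDMottWalkCooperPairDMottPlaquetteDWaveElementKernel
import Summits.HubbardSuperconductivity.HubbardSuperconductivity.Theorems.CooperPairDMottWalkCooperPairDMottPlaquetteDWaveElementEstimate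

/-!
# Route `CooperPairDMottWalk`, crux `CooperPairDMott`: plaquette sector ground states near the
# certified directions, uniqueness of the `(2,0)` ground state, and the `d`-wave element

Helper file for the stub `stub_plaquetteDWaveElement` of the line `Cruxes/CooperPairDMott/Lines/birth.lean`
(item stmt-HubbardSuperconductivity-1177; clauses 2 and 4 of the support item `PlaquettePairBinding`,
stmt-HubbardSuperconductivity-1181), at a FIXED coupling `U`, from abstract certificate hypotheses
(`hcert`: `(E + g) ‖x‖² ≤ hopR x + U dblR x + κ ⟨u, x⟩²` for all real arrays of the sector, `E` an
upper bound of the sector energy):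

* `near_of_cert`: a sector ground state `w` (Rayleigh quotient `e ≤ E`) is close to the line
  `ℂu`: `g ‖w‖² ≤ κ |Σ u w|²` (apply the certificate to `Re w` and `Im w` and add);
* `unique_two_of_cert`: the `(2,0)` sector ground state of the plaquette is unique up to a scalar
  (the certificate is a gap `E + g > e₂` on `Ω^⊥`, `Ω = Γ u`; `isGroundStateInSector_unique_of_gap_orthogonal`);
* `dWaveElement_of_certs`: clauses 2 and 4 at `U` from the two sector certificates and three numeric
  inequalities (`bilinear_ne_zero_of_near_lines` applied to the kernel `pairT` of
  `…PlaquetteDWaveElementKernel`, the directions `u11`, `v22` of `…PlaquetteDWaveElementGram`, and the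
  sector coordinates of `Γᴴ φ₂`, `Γᴴ φ₄`).

Elementary; the physics is Scalapino–Trugman, Phil. Mag. B 74 (1996) 607 (the `2 ↔ 4`-electron
plaquette ground states are connected by a `d_{x²−y²}` pair) and Tsai–Kivelson, PRB 73 (2006) 214510.
-/

set_option linter.dupNamespace false -- the route namespace `HubbardSuperconductivity.HubbardSuperconductivity` is mandated (D-0017)

noncomputable section

namespace Summit.HubbardSuperconductivity.HubbardSuperconductivity.Theorems.CooperPairDMottWalk

open Literature.MathematicalPhysics.QuantumLattice Literature.MathematicalPhysics.QuantumLattice.TwoSpecies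
open Matrix Finset
open scoped ComplexOrder

/-! ### Ground states are near the certified direction -/

section Near

variable {p q : ℕ}

/-- `‖x‖² ≥ 0` for the real norm form. [folklore] -/
theorem nsqR_nonneg (x : Fin p → Fin q → ℝ) : 0 ≤ nsqR x :=
  Finset.sum_nonneg fun _ _ => Finset.sum_nonneg fun _ _ => sq_nonneg _

/-- `normSqW w ≥ 0`. [folklore] -/
theorem normSqW_nonneg (w : Fin p → Fin q → ℂ) : 0 ≤ normSqW w :=
  Finset.sum_nonneg fun _ _ => Finset.sum_nonneg fun _ _ => sq_nonneg _

/-- Real and imaginary parts of `Σ u_{ij} w_{ij}` are the pairings with `Re w`, `Im w`. [folklore] -/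
theorem re_im_sum_intCast_mul (u : Fin p → Fin q → ℤ) (w : Fin p → Fin q → ℂ) :
    (∑ i, ∑ j, (u i j : ℂ) * w i j).re = dotR u (fun i j => (w i j).re) ∧
      (∑ i, ∑ j, (u i j : ℂ) * w i j).im = dotR u (fun i j => (w i j).im) := by
  simp [Complex.re_sum, Complex.im_sum, dotR]

/-- `|Σ u_{ij} w_{ij}|² = ⟨u, Re w⟩² + ⟨u, Im w⟩²`. [folklore] -/
theorem norm_sq_sum_intCast_mul (u : Fin p → Fin q → ℤ) (w : Fin p → Fin q → ℂ) :
    ‖∑ i, ∑ j, (u i j : ℂ) * w i j‖ ^ 2 =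
      dotR u (fun i j => (w i j).re) ^ 2 + dotR u (fun i j => (w i j).im) ^ 2 := by
  obtain ⟨hre, him⟩ := re_im_sum_intCast_mul u w
  rw [Complex.sq_norm, Complex.normSq_apply, hre, him]
  ring

/-- **A sector ground state is close to the certified direction.** If
`(E + g) ‖x‖² ≤ hopR x + U dblR x + κ ⟨u, x⟩²` for all real arrays `x` and the complex array `w` has
Rayleigh quotient `e ≤ E` (`hopForm w + U dblForm w = e ‖w‖²`), then `g ‖w‖² ≤ κ |Σ u w|²`. [folklore] -/
theorem near_of_cert (Ka : Fin p → Fin p → ℤ) (Kb : Fin q → Fin q → ℤ) (d : Fin p → Fin q → ℕ)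
    (u : Fin p → Fin q → ℤ) {U E g κ e : ℝ} (w : Fin p → Fin q → ℂ)
    (hcert : ∀ x, (E + g) * nsqR x ≤ hopR Ka Kb x + U * dblR d x + κ * dotR u x ^ 2)
    (heig : hopForm Ka Kb w + U * dblForm d w = e * normSqW w) (he : e ≤ E) :
    g * normSqW w ≤ κ * ‖∑ i, ∑ j, (u i j : ℂ) * w i j‖ ^ 2 := by
  have h1 := hcert (fun i j => (w i j).re)
  have h2 := hcert (fun i j => (w i j).im)
  have hmono : e * normSqW w ≤ E * normSqW w := mul_le_mul_of_nonneg_right he (normSqW_nonneg w)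
  rw [norm_sq_sum_intCast_mul]
  rw [hopForm_eq_hopR, dblForm_eq_dblR, normSqW_eq_nsqR] at heig
  rw [normSqW_eq_nsqR] at hmono ⊢
  linarith

end Near

/-! ### The two sectors of the plaquette, pulled back to the `Fin 4` model -/

/-- `szSector (1+1) ((1-1)/2) = szSector 2 0`. [folklore] -/
theorem szSector_one_one :
    (szSector (1 + 1) ((((1 : ℕ) : ℝ) - ((1 : ℕ) : ℝ)) / 2) : Submodule ℂ (Fock (Orb PlaquetteSite))) =
      szSector 2 0 := by
  norm_num

/-- `szSector (2+2) ((2-2)/2) = szSector 4 0`. [folklore] -/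
theorem szSector_two_two :
    (szSector (2 + 2) ((((2 : ℕ) : ℝ) - ((2 : ℕ) : ℝ)) / 2) : Submodule ℂ (Fock (Orb PlaquetteSite))) =
      szSector 4 0 := by
  norm_num

/-- A vector of the `(2,0)` sector pulls back to the sector `(1,1)` of the `Fin 4` model. [folklore] -/
theorem isInSector_pull_two {φ : Fock (Orb PlaquetteSite)}
    (hφ : φ ∈ (szSector 2 0 : Submodule ℂ (Fock (Orb PlaquetteSite)))) : IsInSector 1 1 (gamᴴ *ᵥ φ) := by
  have h := mem_szSector_iff_isInSector 1 1 φ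
  rw [szSector_one_one] at h
  exact isInSector_conjTranspose_relabelMatrix_mulVec siteEquiv (h.1 hφ)

/-- A vector of the `(4,0)` sector pulls back to the sector `(2,2)` of the `Fin 4` model. [folklore] -/
theorem isInSector_pull_four {φ : Fock (Orb PlaquetteSite)}
    (hφ : φ ∈ (szSector 4 0 : Submodule ℂ (Fock (Orb PlaquetteSite)))) : IsInSector 2 2 (gamᴴ *ᵥ φ) := by
  have h := mem_szSector_iff_isInSector 2 2 φ
  rw [szSector_two_two] at h
  exact isInSector_conjTranspose_relabelMatrix_mulVec siteEquiv (h.1 hφ)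

/-- Transport of the quadratic form and the norm along `Γᴴ`. [folklore] -/
theorem forms_pull (U : ℝ) (ψ : Fock (Orb PlaquetteSite)) :
    (star (gamᴴ *ᵥ ψ) ⬝ᵥ (ham4 U *ᵥ (gamᴴ *ᵥ ψ))).re = (star ψ ⬝ᵥ (plaquetteHamiltonian U *ᵥ ψ)).re ∧
      (star (gamᴴ *ᵥ ψ) ⬝ᵥ (gamᴴ *ᵥ ψ)).re = (star ψ ⬝ᵥ ψ).re := by
  rw [ham4_mulVec_pull, star_conjTranspose_relabelMatrix_mulVec_dotProduct,
    star_conjTranspose_relabelMatrix_mulVec_dotProduct]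
  exact ⟨rfl, rfl⟩

/-- The Rayleigh identity of a `(2,0)` sector ground state in sector coordinates, and positivity of
its norm. [folklore] -/
theorem sector11_groundState (U : ℝ) {φ : Fock (Orb PlaquetteSite)}
    (hφ : IsGroundStateInSector (plaquetteHamiltonian U) 2 0 φ) :
    hopForm K1 K1 (w11 (gamᴴ *ᵥ φ)) + U * dblForm d11 (w11 (gamᴴ *ᵥ φ)) =
        (plaquetteHamiltonian U).minEnergyOn (szSector 2 0) * normSqW (w11 (gamᴴ *ᵥ φ)) ∧
      0 < normSqW (w11 (gamᴴ *ᵥ φ)) := by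
  obtain ⟨hmem, hne, hH⟩ := hφ
  have hψ : IsInSector 1 1 (gamᴴ *ᵥ φ) := isInSector_pull_two hmem
  obtain ⟨hH4, hnorm⟩ := eigen_pull U hH
  obtain ⟨hn, hHf⟩ := sector11_forms U hψ
  refine ⟨?_, ?_⟩
  · rw [← hHf, hH4, dotProduct_smul, smul_eq_mul, Complex.re_ofReal_mul, hn]
  · rw [← hn, hnorm]
    exact (Complex.pos_iff.mp (dotProduct_star_self_pos_iff.2 hne)).1

/-- The Rayleigh identity of a `(4,0)` sector ground state in sector coordinates, and positivity of
its norm. [folklore] -/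
theorem sector22_groundState (U : ℝ) {φ : Fock (Orb PlaquetteSite)}
    (hφ : IsGroundStateInSector (plaquetteHamiltonian U) 4 0 φ) :
    hopForm K2 K2 (w22 (gamᴴ *ᵥ φ)) + U * dblForm d22 (w22 (gamᴴ *ᵥ φ)) =
        (plaquetteHamiltonian U).minEnergyOn (szSector 4 0) * normSqW (w22 (gamᴴ *ᵥ φ)) ∧
      0 < normSqW (w22 (gamᴴ *ᵥ φ)) := by
  obtain ⟨hmem, hne, hH⟩ := hφ
  have hψ : IsInSector 2 2 (gamᴴ *ᵥ φ) := isInSector_pull_four hmem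
  obtain ⟨hH4, hnorm⟩ := eigen_pull U hH
  obtain ⟨hn, hHf⟩ := sector22_forms U hψ
  refine ⟨?_, ?_⟩
  · rw [← hHf, hH4, dotProduct_smul, smul_eq_mul, Complex.re_ofReal_mul, hn]
  · rw [← hn, hnorm]
    exact (Complex.pos_iff.mp (dotProduct_star_self_pos_iff.2 hne)).1

/-! ### Clause 2: uniqueness of the `(2,0)` sector ground state -/

/-- The vector `Ω = Γ u` built from the integer direction `u11`. [folklore] -/
def omega11 : Fock (Orb PlaquetteSite) :=
  gam *ᵥ ofSectorArray s1 s1 (fun i j => ((u11 i j : ℤ) : ℂ))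

/-- `⟨Ω, ψ⟩ = Σ u_{ij} W(Γᴴ ψ)_{ij}`. [folklore] -/
theorem star_omega11_dotProduct (ψ : Fock (Orb PlaquetteSite)) :
    star omega11 ⬝ᵥ ψ = ∑ i, ∑ j, (u11 i j : ℂ) * w11 (gamᴴ *ᵥ ψ) i j := by
  have huv : IsInSector 1 1 (ofSectorArray s1 s1 (fun i j => ((u11 i j : ℤ) : ℂ))) :=
    isInSector_ofSectorArray isSubsetEnum_s1 isSubsetEnum_s1 _
  rw [omega11]
  conv_lhs => rw [← relabelMatrix_mulVec_conjTranspose_mulVec orbEquiv ψ,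
    star_relabelMatrix_mulVec_dotProduct]
  rw [sector_star_dotProduct isSubsetEnum_s1 isSubsetEnum_s1 huv]
  refine Finset.sum_congr rfl fun i _ => Finset.sum_congr rfl fun j _ => ?_
  rw [coeffMatrix_ofSectorArray isSubsetEnum_s1 isSubsetEnum_s1, w11]
  simp

/-- **Clause 2 from a certificate.** If `(E + g) ‖x‖² ≤ hopR x + U dblR x + κ ⟨u11, x⟩²` for all
real `4 × 4` arrays, with `E ≥ e₂⁰(U)` and `g > 0`, then the `(2,0)` sector ground state of the
plaquette is unique up to a scalar (the form is `≥ E + g > e₂⁰` on `Ω^⊥`). [folklore] -/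
theorem unique_two_of_cert {U E g κ : ℝ} (hg : 0 < g)
    (hcert : ∀ x, (E + g) * nsqR x ≤ hopR K1 K1 x + U * dblR d11 x + κ * dotR u11 x ^ 2)
    (hE : (plaquetteHamiltonian U).minEnergyOn (szSector 2 0) ≤ E) :
    ∀ φ₁ φ₂, IsGroundStateInSector (plaquetteHamiltonian U) 2 0 φ₁ →
      IsGroundStateInSector (plaquetteHamiltonian U) 2 0 φ₂ → ∃ c : ℂ, φ₂ = c • φ₁ := by
  refine isGroundStateInSector_unique_of_gap_orthogonal _ 2 0 omega11 (E + g) (by linarith)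
    fun ψ hψ hΩ => ?_
  have hψ' : IsInSector 1 1 (gamᴴ *ᵥ ψ) := isInSector_pull_two hψ
  set w := w11 (gamᴴ *ᵥ ψ) with hw
  rw [star_omega11_dotProduct] at hΩ
  obtain ⟨hre, him⟩ := re_im_sum_intCast_mul u11 w
  rw [hΩ] at hre him
  simp only [Complex.zero_re, Complex.zero_im] at hre him
  have h1 := hcert (fun i j => (w i j).re)
  have h2 := hcert (fun i j => (w i j).im)
  rw [← hre] at h1
  rw [← him] at h2
  obtain ⟨hn, hHf⟩ := sector11_forms U hψ'
  obtain ⟨hHt, hnt⟩ := forms_pull U ψ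
  rw [← hHt, ← hnt, hn, hHf, normSqW_eq_nsqR, hopForm_eq_hopR, dblForm_eq_dblR]
  simp only [← hw] at h1 h2 ⊢
  nlinarith [h1, h2]

/-! ### Clause 4: the `d`-wave matrix element from the two certificates -/

/-- The integer constants of the kernel and the directions: `|u|² = 993664`, `|v|² = 113872`,
`|Tᵀu|² = 122454016`, `|T|_F² = 1152`, `uᵀ T v = 3564032` (kernel evaluation). [folklore] -/
theorem pairT_constants :
    (∑ a : Fin 4 × Fin 4, u11 a.1 a.2 ^ 2 : ℤ) = 993664 ∧
      (∑ c : Fin 6 × Fin 6, v22 c.1 c.2 ^ 2 : ℤ) = 113872 ∧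
      (∑ c : Fin 6 × Fin 6, (∑ a : Fin 4 × Fin 4, u11 a.1 a.2 * pairT a.1 a.2 c.1 c.2) ^ 2 : ℤ) =
          122454016 ∧
      (∑ a : Fin 4 × Fin 4, ∑ c : Fin 6 × Fin 6, pairT a.1 a.2 c.1 c.2 ^ 2 : ℤ) = 1152 ∧
      (∑ a : Fin 4 × Fin 4, ∑ c : Fin 6 × Fin 6, u11 a.1 a.2 * pairT a.1 a.2 c.1 c.2 * v22 c.1 c.2 : ℤ) =
          3564032 := by
  refine ⟨?_, ?_, ?_, ?_, ?_⟩ <;> decide +kernel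

/-- **Clauses 2 and 4 at a fixed `U` from the two sector certificates.** Given certificates
`(E₂ + g₂) ‖x‖² ≤ hopR x + U dblR x + 10⁻⁶ ⟨u11, x⟩²` (sector `(1,1)`, `16`-dim) and
`(E₄ + g₄) ‖x‖² ≤ hopR x + U dblR x + 10⁻⁶ ⟨v22, x⟩²` (sector `(2,2)`, `36`-dim) with
`E₂ ≥ e₂⁰(U)`, `E₄ ≥ e₄⁰(U)`, `g₂, g₄ > 0`, and numbers `A₁, A₂ ≥ 0` with
`A₁² ≥ |Tᵀu|² n_v (n_v 10⁻⁶/g₄ − 1)`, `A₂² ≥ |T|_F² n_u (n_u 10⁻⁶/g₂ − 1) n_v (n_v 10⁻⁶/g₄)`,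
`A₁ + A₂ < uᵀTv = 3564032`: the `(2,0)` ground state of the plaquette is unique up to a scalar and
`⟨φ₂, Δ_d φ₄⟩ ≠ 0` for all `(2,0)` and `(4,0)` sector ground states. [folklore] -/
theorem dWaveElement_of_certs {U E₂ g₂ E₄ g₄ A₁ A₂ : ℝ}
    (hcert2 : ∀ x, (E₂ + g₂) * nsqR x ≤ hopR K1 K1 x + U * dblR d11 x + (1 / 10 ^ 6) * dotR u11 x ^ 2)
    (hcert4 : ∀ x, (E₄ + g₄) * nsqR x ≤ hopR K2 K2 x + U * dblR d22 x + (1 / 10 ^ 6) * dotR v22 x ^ 2)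
    (hE2 : (plaquetteHamiltonian U).minEnergyOn (szSector 2 0) ≤ E₂)
    (hE4 : (plaquetteHamiltonian U).minEnergyOn (szSector 4 0) ≤ E₄)
    (hg2 : 0 < g₂) (hg4 : 0 < g₄) (hA₁ : 0 ≤ A₁) (hA₂ : 0 ≤ A₂)
    (h1 : (122454016 : ℝ) * (113872 * (113872 * (1 / 10 ^ 6) / g₄ - 1)) ≤ A₁ ^ 2)
    (h2 : (1152 : ℝ) * (993664 * (993664 * (1 / 10 ^ 6) / g₂ - 1)) *
      (113872 * (113872 * (1 / 10 ^ 6) / g₄)) ≤ A₂ ^ 2)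
    (h3 : A₁ + A₂ < 3564032) :
    (∀ φ₁ φ₂, IsGroundStateInSector (plaquetteHamiltonian U) 2 0 φ₁ →
        IsGroundStateInSector (plaquetteHamiltonian U) 2 0 φ₂ → ∃ c : ℂ, φ₂ = c • φ₁) ∧
      (∀ φ₂ φ₄, IsGroundStateInSector (plaquetteHamiltonian U) 2 0 φ₂ →
        IsGroundStateInSector (plaquetteHamiltonian U) 4 0 φ₄ →
          star φ₂ ⬝ᵥ (pairField dWaveFormFactor 2 *ᵥ φ₄) ≠ 0) := by
  refine ⟨unique_two_of_cert hg2 hcert2 hE2, fun φ₂ φ₄ h₂ h₄ => ?_⟩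
  have hψ₂ : IsInSector 1 1 (gamᴴ *ᵥ φ₂) := isInSector_pull_two h₂.1
  have hψ₄ : IsInSector 2 2 (gamᴴ *ᵥ φ₄) := isInSector_pull_four h₄.1
  obtain ⟨heig2, hpos2⟩ := sector11_groundState U h₂
  obtain ⟨heig4, hpos4⟩ := sector22_groundState U h₄
  have hnear2 := near_of_cert K1 K1 d11 u11 _ hcert2 heig2 hE2
  have hnear4 := near_of_cert K2 K2 d22 v22 _ hcert4 heig4 hE4
  set p : Fin 4 → Fin 4 → ℂ := w11 (gamᴴ *ᵥ φ₂) with hp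
  set s : Fin 6 → Fin 6 → ℂ := w22 (gamᴴ *ᵥ φ₄) with hs
  rw [star_dotProduct_pairField_mulVec, star_dotProduct_pairOp4_mulVec hψ₂ hψ₄]
  refine mul_ne_zero ?_ ?_
  · have : (0 : ℝ) < 1 / Real.sqrt 2 := by positivity
    exact_mod_cast this.ne'
  obtain ⟨cnu, cnv, cNw, cF, ct0⟩ := pairT_constants
  have key := bilinear_ne_zero_of_near_lines (fun (a : Fin 4 × Fin 4) (c : Fin 6 × Fin 6) =>
      pairT a.1 a.2 c.1 c.2) (fun a => u11 a.1 a.2) (fun c => v22 c.1 c.2) (fun a => p a.1 a.2)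
    (fun c => s c.1 c.2) (gu := g₂) (κu := 1 / 10 ^ 6) (gv := g₄) (κv := 1 / 10 ^ 6)
    (nu := 993664) (nv := 113872) (Nw := 122454016) (F := 1152) (t0 := 3564032)
    (by exact_mod_cast cnu) (by exact_mod_cast cnv) (by exact_mod_cast cNw) (by exact_mod_cast cF)
    (by exact_mod_cast ct0) hg2 hg4
    (by simpa only [normSqW, Fintype.sum_prod_type] using hpos2)
    (by simpa only [normSqW, Fintype.sum_prod_type] using hpos4)
    (by simpa only [normSqW, Fintype.sum_prod_type] using hnear2)
    (by simpa only [normSqW, Fintype.sum_prod_type] using hnear4)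
    hA₁ hA₂ h1 h2 (by rwa [abs_of_pos (by norm_num : (0 : ℝ) < 3564032)])
  simpa only [Fintype.sum_prod_type] using key

/-! ### Registered sub-goal of the crux item (stmt-HubbardSuperconductivity-1177) -/

/-- Registered sub-goal `dWaveElement_nearOfCert` of the crux item: a sector ground state is close to the certified direction (`near_of_cert`, restated with `dotR` unfolded). [folklore] -/
theorem dWaveElement_nearOfCert : ∀ {p q : ℕ} (Ka : Fin p → Fin p → ℤ) (Kb : Fin q → Fin q → ℤ) (d : Fin p → Fin q → ℕ) (u : Fin p → Fin q → ℤ) {U E g κ e : ℝ} (w : Fin p → Fin q → ℂ), (∀ x : Fin p → Fin q → ℝ, (E + g) * Summit.HubbardSuperconductivity.HubbardSuperconductivity.Theorems.CooperPairDMottWalk.nsqR x ≤ Summit.HubbardSuperconductivity.HubbardSuperconductivity.Theorems.CooperPairDMottWalk.hopR Ka Kb x + U * Summit.HubbardSuperconductivity.HubbardSuperconductivity.Theorems.CooperPairDMottWalk.dblR d x + κ * (∑ i, ∑ j, (u i j : ℝ) * x i j) ^ 2) → Literature.MathematicalPhysics.QuantumLattice.TwoSpecies.hopForm Ka Kb w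 + U * Literature.MathematicalPhysics.QuantumLattice.TwoSpecies.dblForm d w = e * Literature.MathematicalPhysics.QuantumLattice.TwoSpecies.normSqW w → e ≤ E → g * Literature.MathematicalPhysics.QuantumLattice.TwoSpecies.normSqW w ≤ κ * ‖∑ i, ∑ j, (u i j : ℂ) * w i j‖ ^ 2 :=
  by
  intro p q Ka Kb d u U E g κ e w hcert heig he
  exact near_of_cert Ka Kb d u w hcert heig he

end Summit.HubbardSuperconductivity.HubbardSuperconductivity.Theorems.CooperPairDMottWalk
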